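import Literature.Computability.AlgebraicComplexity.CapabilityBound
import Literature.Computability.AlgebraicComplexity.HwvIdealDegreeCriterion
import Literature.Computability.AlgebraicComplexity.HwvIdealRankBound

/-!
# The per-side Pieri ceiling for padded forms (`x₀₀^{m-n} h'` on its own)

For `0 < n < m`, characteristic zero, ANY form `h'` of degree `n` on the `n × n` letters and `λ ⊢ m d` with `d ≠ 0`
and at most `m²` parts:
`mult_{λ*} k[Δ(x₀₀^{m-n} h')] ≤ Σ_{λ/μ horizontal strip, μ ⊢ n d, ℓ(μ) ≤ n²} a_{μ*}`
(`orbitMultiplicity_pad_le_sum_plethysmCoeff_pieri`; the padded permanent `paddedPerFormLex k n m` in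
`orbitMultiplicity_paddedPerFormLex_le_sum_plethysmCoeff_pieri`).  This is a multiplicity form of the Kadish–Landsberg
analysis of padded polynomials (Landsberg 2017 §8.4.2, Prop. 8.4.2.1; Ikenmeyer–Panova 2017 Prop. 2.6): a type `λ*` of the
orbit closure of a padded form is a horizontal strip over a few-row type `μ*` of the un-padded degree, and its multiplicity
is at most the total plethysm coefficient of those predecessors.  It is the cell `pub-gct-max`'s PER-CEILING instrument
(the second term of `t_obs = min(a_λ(d[m]), Σ_Pieri a_μ(d[n]))`).
## Proof
The `h := 0` case of `CapabilityBound`'s (C1-Pieri) `orbitMultiplicity_pad_le_add_sum_hwDeficit_pieri` along the Borel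
placement: the reference orbit closure `Δ(x₀₀^{m-n} · 0) = Δ(0)` is the origin, so it carries no type of degree `d ≥ 1`
(`orbitMultiplicity_zero_eq_zero`: a highest weight vector of degree `d ≥ 1` in the coefficients has no constant term), and the
deficit of the zero form at `μ*` is the full plethysm coefficient; then the placement swap `orbitMultiplicity_pad_rename_eq_rename`
and Step D `sum_padPieriWeights_hwDeficit_le_capDeficitSumPieri` of `CapabilityBound`.  No named facts; no new definitions.
Honest framing (cell `pub-gct-max`): an elementary representation-theoretic bound assembled from printed parts — an INSTRUMENT
saying where a multiplicity obstruction cannot live (inequality only; the plethysm values are census data); multiplicity data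
and certified rank bounds at small parameters; occurrence obstructions are ruled out in print (BIP'16) — multiplicity
obstructions are the open door; nothing here is a claim on VP vs VNP or P vs NP.
## References
* [Landsberg2017] §8.4.2 (Prop. 8.4.2.1, 8.4.2.2, 8.4.2.4), Thm. 8.1.3.1; [KadishLandsberg2014] §2;
  [IkenmeyerPanova2017] §2.2 (`0 ≤ o_λ ≤ a_λ`), Prop. 2.6; [BurgisserEtAl2011] Prop. 6.3.2, §6.3; [FultonHarrisGTM129] (6.8) (Pieri).
-/

noncomputable section

open MvPolynomial

namespace Literature.Computability.AlgebraicComplexity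

open _root_.Literature.NumberTheory.DiophantineGeometry

section ZeroForm

variable {k : Type} [Field k] {σ : Type} [Fintype σ] [LinearOrder σ]

/-- Highest weight vectors of `k[Sym^m k^σ]` of weight `χ` with `|χ| = -m d`, `d ≠ 0`, vanish on the orbit of the ZERO
form: they are homogeneous of degree `d ≥ 1` in the coefficients, hence have no constant term, and the orbit of `0` is the
origin.  (The degenerate case of `0 ≤ o_λ ≤ a_λ` for the orbit closure `{0}`.)
[cite: IkenmeyerPanova2017, §2.2 (0 ≤ o_λ ≤ a_λ; orbit closure of the zero form)] -/
theorem highestWeightSpace_le_orbitVanishingIdeal_zero [Infinite k] {m d : ℕ} (hm : m ≠ 0) (hd : d ≠ 0)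
    {χ : Weight σ} (hχ : χ.size = -((m * d : ℕ) : ℤ)) :
    highestWeightSpace (coordRep σ k m) χ ≤
      (orbitVanishingIdeal (0 : MvPolynomial σ k) m).restrictScalars k := by
  intro F hF
  have hFd : F.IsHomogeneous d :=
    isHomogeneous_of_mem_weightSpace_of_size_eq hm hχ (highestWeightSpace_le_weightSpace _ _ hF)
  rw [Submodule.restrictScalars_mem, mem_orbitVanishingIdeal_iff]
  intro g
  rw [map_zero]
  have h0 : formCoeff m (0 : MvPolynomial σ k) = 0 := by
    funext D; simp [formCoeff_apply]
  rw [h0, MvPolynomial.aeval_zero]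
  have hc : constantCoeff F = 0 := by
    rw [constantCoeff_eq, hFd.coeff_eq_zero]
    rw [map_zero]
    exact fun h => hd h.symm
  rw [hc, map_zero]

/-- **The orbit closure of the zero form carries no type of positive degree**: `mult_χ k[Δ_m(0)] = 0` for
`|χ| = -m d`, `d ≠ 0` (characteristic zero).
[cite: IkenmeyerPanova2017, §2.2 (0 ≤ o_λ ≤ a_λ; orbit closure of the zero form)] -/
theorem orbitMultiplicity_zero_eq_zero [CharZero k] {m d : ℕ} (hm : m ≠ 0) (hd : d ≠ 0) {χ : Weight σ}
    (hχ : χ.size = -((m * d : ℕ) : ℤ)) :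
    orbitMultiplicity k (0 : MvPolynomial σ k) m χ = 0 := by
  haveI : Infinite k := CharZero.infinite k
  have h := orbitMultiplicity_add_finrank_inf_eq_plethysmCoeff (0 : MvPolynomial σ k) hm χ
  have hinf : highestWeightSpace (coordRep σ k m) χ ⊓
      (orbitVanishingIdeal (0 : MvPolynomial σ k) m).restrictScalars k =
        highestWeightSpace (coordRep σ k m) χ :=
    inf_eq_left.mpr (highestWeightSpace_le_orbitVanishingIdeal_zero hm hd hχ)
  rw [hinf] at h
  have hp : plethysmCoeff k σ m χ = Module.finrank k ↥(highestWeightSpace (coordRep σ k m) χ) := rfl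
  omega

/-- The deficit `a_π - mult_π k[Δ_m(0)]` of the zero form is at most the plethysm coefficient `a_π`. [folklore] -/
private theorem hwDeficit_zero_le (m : ℕ) (π : Weight σ) :
    hwDeficit k (0 : MvPolynomial σ k) m π ≤ plethysmCoeff k σ m π :=
  Nat.sub_le _ _

end ZeroForm

section Matrix

variable {k : Type} [Field k]

/-- The Borel-compatible placement is strictly monotone (copy of `CapabilityBound`'s private lemma). [folklore] -/
private theorem borelPlace_strictMono' {n m : ℕ} (hnm : n ≤ m) : StrictMono (borelPlace hnm) :=
  fun _ _ hxy => (matIdxEquiv m).strictMono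
    (topEmb_strictMono _ ((matIdxEquiv n).symm.strictMono hxy))

/-- The range of the Borel-compatible placement (copy of `CapabilityBound`'s private lemma). [folklore] -/
private theorem range_borelPlace' {n m : ℕ} (hnm : n ≤ m) :
    Set.range (borelPlace hnm) =
      Set.range (fun i => matIdxEquiv m (topEmb (Nat.mul_le_mul hnm hnm) i)) := by
  ext y
  constructor
  · rintro ⟨x, rfl⟩
    exact ⟨(matIdxEquiv n).symm x, rfl⟩
  · rintro ⟨i, rfl⟩
    exact ⟨matIdxEquiv n i, by unfold borelPlace; rw [OrderIso.symm_apply_apply]⟩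

/-- The range of the Borel-compatible placement is an upper set (copy of `CapabilityBound`'s private lemma).
[folklore] -/
private theorem isUpperSet_range_borelPlace' {n m : ℕ} (hnm : n ≤ m) :
    IsUpperSet (Set.range (borelPlace hnm)) := by
  rw [range_borelPlace']
  exact (strictMono_comp_topEmb (matIdxEquiv m) (Nat.mul_le_mul hnm hnm)).2

/-- `x₀₀` is the least matrix letter (copy of `CapabilityBound`'s private lemma). [folklore] -/
private theorem toLex_zero_le' (m : ℕ) [NeZero m] (y : MatIdx m) : toLex ((0 : Fin m), (0 : Fin m)) ≤ y := by
  rw [← toLex_ofLex y, Prod.Lex.le_iff]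
  rcases (Fin.zero_le (ofLex y).1).lt_or_eq with h | h
  · exact Or.inl h
  · exact Or.inr ⟨h, Fin.zero_le _⟩

/-- `x₀₀` is not among the last `n²` matrix letters when `n < m` (copy of `CapabilityBound`'s private lemma).
[folklore] -/
private theorem toLex_zero_not_mem_range_borelPlace' {n m : ℕ} [NeZero m] (hnm : n < m) :
    toLex ((0 : Fin m), (0 : Fin m)) ∉ Set.range (borelPlace hnm.le) := by
  intro ht
  have hsurj : Function.Surjective (borelPlace hnm.le) := fun y =>
    isUpperSet_range_borelPlace' hnm.le (toLex_zero_le' m y) ht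
  have hcard := Fintype.card_le_of_surjective _ hsurj
  simp only [MatIdx, Fintype.card_lex, Fintype.card_prod, Fintype.card_fin] at hcard
  have := Nat.mul_self_lt_mul_self hnm
  omega

/-- **The per-side Pieri ceiling** (`h := 0` case of (C1-Pieri)).  `0 < n < m`, characteristic zero, `h'` any form of
degree `n` on the `n × n` letters, `λ ⊢ m d` with `d ≠ 0` and at most `m²` parts:
`mult_{λ*} k[Δ(x₀₀^{m-n} h')] ≤ Σ_{λ/μ horizontal strip, μ ⊢ n d, ℓ(μ) ≤ n²} a_{μ*}` — a type of the orbit closure of a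
padded form is a horizontal strip over a few-row type of the un-padded degree (Kadish–Landsberg), counted with multiplicity.
[cite: Landsberg2017, Prop. 8.4.2.1 and §8.4.2] [cite: KadishLandsberg2014, §2] [cite: IkenmeyerPanova2017, Prop. 2.6 (held: Prop. 13)]
[cite: FultonHarrisGTM129, (6.8)] -/
theorem orbitMultiplicity_pad_le_sum_plethysmCoeff_pieri [CharZero k] {n m : ℕ} [NeZero n] [NeZero m]
    (hnm : n < m) {h' : MvPolynomial (MatIdx n) k} (hh' : h'.IsHomogeneous n) {d : ℕ} (hd : d ≠ 0)
    (lam : Nat.Partition (m * d)) (hlam : lam.parts.card ≤ m * m) :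
    orbitMultiplicity k (X (toLex ((0 : Fin m), (0 : Fin m))) ^ (m - n) * rename (blockPlace hnm.le) h') m
        (Weight.dualOfPartition (m * m) lam).toMatIdx ≤
      ∑ mu ∈ (Finset.univ : Finset (Nat.Partition (n * d))).filter
          (fun mu => mu.parts.card ≤ n * n ∧ partHorizStrip (m * m) mu lam),
        plethysmCoeff k (MatIdx n) n (Weight.dualOfPartition (n * n) mu).toMatIdx := by
  haveI : Infinite k := CharZero.infinite k
  have hm : m ≠ 0 := NeZero.ne m
  set t : MatIdx m := toLex ((0 : Fin m), (0 : Fin m)) with ht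
  set Λ : Weight (MatIdx m) := (Weight.dualOfPartition (m * m) lam).toMatIdx with hΛ
  have htb := toLex_zero_not_mem_range_blockPlace (n := n) (m := m) hnm
  have hti := toLex_zero_not_mem_range_borelPlace' (n := n) (m := m) hnm
  have hχ : Λ.size = -(((n + (m - n)) * d : ℕ) : ℤ) := by
    rw [Nat.add_sub_cancel' hnm.le]
    exact size_toMatIdx_dualOfPartition (m := m) lam hlam
  -- (C1-Pieri) along the Borel placement with reference form `0`
  have key := orbitMultiplicity_pad_le_add_sum_hwDeficit_pieri (borelPlace_strictMono' hnm.le)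
    (isUpperSet_range_borelPlace' hnm.le) hti (NeZero.ne n)
    (isHomogeneous_zero (MatIdx n) k n) hh' hχ
  rw [Nat.add_sub_cancel' hnm.le] at key
  -- the reference term vanishes: `Δ(x₀₀^{m-n} · 0) = Δ(0)` has no type of degree `d ≥ 1`
  have hzero : orbitMultiplicity k (X t ^ (m - n) * rename (borelPlace hnm.le) (0 : MvPolynomial (MatIdx n) k))
      m Λ = 0 := by
    rw [map_zero, mul_zero]
    exact orbitMultiplicity_zero_eq_zero hm hd (size_toMatIdx_dualOfPartition (m := m) lam hlam)
  rw [hzero, zero_add] at key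
  -- block placement versus Borel placement
  rw [orbitMultiplicity_pad_rename_eq_rename (blockPlace hnm.le) (borelPlace hnm.le)
    (blockPlace_injective hnm.le) (borelPlace_strictMono' hnm.le).injective htb hti h' (m - n) hm Λ]
  -- Step D (weight-indexed Pieri sum ≤ partition-indexed Pieri sum) and `deficit(0) ≤ a`
  have hsum := sum_padPieriWeights_hwDeficit_le_capDeficitSumPieri (k := k) hnm
    (0 : MvPolynomial (MatIdx n) k) lam hlam
  have hcap : capDeficitSumPieri (0 : MvPolynomial (MatIdx n) k) m d lam ≤
      ∑ mu ∈ (Finset.univ : Finset (Nat.Partition (n * d))).filter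
          (fun mu => mu.parts.card ≤ n * n ∧ partHorizStrip (m * m) mu lam),
        plethysmCoeff k (MatIdx n) n (Weight.dualOfPartition (n * n) mu).toMatIdx := by
    unfold capDeficitSumPieri
    exact Finset.sum_le_sum fun mu _ => hwDeficit_zero_le _ _
  exact key.trans (hsum.trans hcap)

/-- **The per-side Pieri ceiling for the padded permanent `x₀₀^{m-n} per_n`** (`paddedPerFormLex k n m`), `0 < n < m`,
`d ≠ 0`: `mult_{λ*} k[Δ(x₀₀^{m-n} per_n)] ≤ Σ_{λ/μ horizontal strip, μ ⊢ n d, ℓ(μ) ≤ n²} a_{μ*}`.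
[cite: Landsberg2017, Prop. 8.4.2.4 and §8.4.2] [cite: KadishLandsberg2014, §2] [cite: IkenmeyerPanova2017, Prop. 2.6 (held: Prop. 13)] -/
theorem orbitMultiplicity_paddedPerFormLex_le_sum_plethysmCoeff_pieri [CharZero k] {n m : ℕ} [NeZero n]
    [NeZero m] (hnm : n < m) {d : ℕ} (hd : d ≠ 0) (lam : Nat.Partition (m * d))
    (hlam : lam.parts.card ≤ m * m) :
    orbitMultiplicity k (paddedPerFormLex k n m) m (Weight.dualOfPartition (m * m) lam).toMatIdx ≤
      ∑ mu ∈ (Finset.univ : Finset (Nat.Partition (n * d))).filter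
          (fun mu => mu.parts.card ≤ n * n ∧ partHorizStrip (m * m) mu lam),
        plethysmCoeff k (MatIdx n) n (Weight.dualOfPartition (n * n) mu).toMatIdx := by
  rw [paddedPerFormLex_eq_pad hnm.le]
  have hper : (rename toLex (perPoly (Fin n) k) : MvPolynomial (MatIdx n) k).IsHomogeneous n := by
    have h := (perPoly_isHomogeneous (n := Fin n) (k := k)).rename_isHomogeneous (f := toLex)
    rwa [Fintype.card_fin] at h
  exact orbitMultiplicity_pad_le_sum_plethysmCoeff_pieri hnm hper hd lam hlam

/-- The cell `pub-gct-max`'s PER-CEILING instrument at `(n, m) = (3, 4)`: a type `λ ⊢ 4d` of `k[Δ(x₀₀ per₃)]` has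
multiplicity at most the total plethysm coefficient `Σ a_{μ*}`, `μ ⊢ 3d`, `ℓ(μ) ≤ 9`, `λ/μ` a horizontal strip (used on
`(11,11,8,3,3,2,2,2,1,1) ⊢ 44`: one Pieri predecessor `(11,8,3,3,2,2,2,1,1)`, ceiling `4`). [folklore] -/
example [CharZero k] {d : ℕ} (hd : d ≠ 0) (lam : Nat.Partition (4 * d)) (hlam : lam.parts.card ≤ 4 * 4) :
    orbitMultiplicity k (paddedPerFormLex k 3 4) 4 (Weight.dualOfPartition (4 * 4) lam).toMatIdx ≤
      ∑ mu ∈ (Finset.univ : Finset (Nat.Partition (3 * d))).filter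
          (fun mu => mu.parts.card ≤ 3 * 3 ∧ partHorizStrip (4 * 4) mu lam),
        plethysmCoeff k (MatIdx 3) 3 (Weight.dualOfPartition (3 * 3) mu).toMatIdx :=
  orbitMultiplicity_paddedPerFormLex_le_sum_plethysmCoeff_pieri (by norm_num) hd lam hlam

/-- The same instrument at `(n, m) = (3, 5)` (the cell's `t_obs5` ceiling term for `x₀₀² per₃`). [folklore] -/
example [CharZero k] {d : ℕ} (hd : d ≠ 0) (lam : Nat.Partition (5 * d)) (hlam : lam.parts.card ≤ 5 * 5) :
    orbitMultiplicity k (paddedPerFormLex k 3 5) 5 (Weight.dualOfPartition (5 * 5) lam).toMatIdx ≤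
      ∑ mu ∈ (Finset.univ : Finset (Nat.Partition (3 * d))).filter
          (fun mu => mu.parts.card ≤ 3 * 3 ∧ partHorizStrip (5 * 5) mu lam),
        plethysmCoeff k (MatIdx 3) 3 (Weight.dualOfPartition (3 * 3) mu).toMatIdx :=
  orbitMultiplicity_paddedPerFormLex_le_sum_plethysmCoeff_pieri (by norm_num) hd lam hlam

end Matrix

end Literature.Computability.AlgebraicComplexity
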